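import Literature.MeasureTheory.Group.InvariantQuotientNormalized
import Literature.MeasureTheory.Group.CoveringWeights
import HarnessLib

/-!
# Unfolding a lattice-invariant integral along a quotient homomorphism (covering-weight form):
# `∫_{Γ∖G} g(α x) dx = C · ∫_{Λ∖Q} g(q) dq` for `α : G ↠ Q`, `Λ = α(Γ)`, `vol((Γ ∩ ker α)∖ker α) < ∞`
(Weil, *L'intégration dans les groupes topologiques et ses applications* (1940), §9 (integration on
quotients by weights; the measure on `G/G′`); Bourbaki, *Intégration* VII §2 no. 3–4, no. 8 (quasi-invariant
measures, transitivity); Folland, *A Course in Abstract Harmonic Analysis* (1995), §2.6 Thm. 2.49;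
Rogawski, *Automorphic Representations of Unitary Groups in Three Variables* (1990), §7.2 p. 94 and §7.3
p. 97 — the passage `∫_{𝐙M∖𝐌} (…)(α₃(m)) dm = m(𝐙S∖𝐒) ∫_{NE^*∖NI_E} (…)(a) da`, `S = ker α₃`, which is the
application in view)

Topic `MeasureTheory/Group`; namespace `Literature.MeasureTheory.Group`. THEOREMS ONLY over accepted tree
modules (no definition, no instance, no named fact, no `sorry`).

SETTING. `G`, `Q` locally compact, second countable, Hausdorff ABELIAN groups with Haar measures `μG`,
`μQ`; a continuous OPEN surjective homomorphism `α : G →* Q` with kernel `S = α.ker` (closed) carrying a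
Haar measure `μS`; a countable discrete subgroup `Γ ≤ G` with image `Λ = Γ.map α ≤ Q` and fibre lattice
`Γ_S = Γ ⊓ S` (as `Γ.subgroupOf α.ker ≤ S`). Integrals over `Γ∖G`, `Λ∖Q`, `Γ_S∖S` are written, as in the
automorphic files of the tree (★ `UnitaryGroupTorusCoveringWeights`, ★ `UnitaryGroupBorelCosetSumUnfolding`),
against COVERING WEIGHTS (★ `IsCoveringWeight`: Borel `w ≥ 0` with `Σ_{γ ∈ Γ} w(γ x) = 1`) rather than on
coset spaces. The one hypothesis beyond the setting is a witness that `Γ_S∖S` has FINITE VOLUME: a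
`Γ_S`-covering weight `wS` on `S` with `∫ wS dμS < ∞` (for `Γ_S∖S` compact any weight will do).

THE THEOREM (**`exists_lintegral_comp_mul_weight_eq_mul_lintegral`**). There is `C ∈ (0, ∞)` such that for
every `Γ`-covering weight `w` on `G`, every `Λ`-covering weight `wQ` on `Q` and every Borel `Λ`-invariant
`g : Q → [0, ∞]`,

  `∫⁻ g (α x) * w x ∂μG = C * ∫⁻ g q * wQ q ∂μQ`.

(`C = ∫ wS dμS ×` the Haar comparison constant of `α_*`; only `C ∈ (0, ∞)` is asserted.) PROOF. (1) The
left side does not depend on the covering weight (★ `lintegral_mul_eq_of_coveringSum_eq`), so `w` may be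
replaced by `(wQ ∘ α) · v` with `v` any `Γ_S`-covering weight on `G` — this IS a `Γ`-covering weight, the
sum over `Γ` being the sum over `Λ` of the sums over the `Γ_S`-cosets (§1). (2) Weil's formula along `S`
with constant one for the quotient measure (★ `lintegral_fiberLIntegral_quotientMeasure`): the fibre integral
of `(g wQ) ∘ α · v` over `x S` is `g(αx) wQ(αx) · ∫_S v(x s) ds`, and `∫_S v(x s) ds = ∫_S wS` for every `x`
(`s ↦ v(x s)` is again a `Γ_S`-covering weight on `S`; weight-independence on `S`) (§2). (3) `G ⧸ S ≃* Q`
(Mathlib `QuotientGroup.quotientKerEquivOfSurjective`) is a homeomorphism (`α` open), so the transported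
quotient measure is a left-invariant Radon measure on `Q`, i.e. a positive multiple of `μQ` (Mathlib
`isMulLeftInvariant_eq_smul`) (§3).

* §1 `isClosed_ker_of_continuous`; `coveringSum_comp_smul_eq` (a `Λ`-invariant `g ∘ α` is `Γ`-invariant);
  **`isCoveringWeight_comp_mul`** (`(wQ ∘ α) · v` is a `Γ`-covering weight); `exists_isCoveringWeight_fibre`.
* §2 `isCoveringWeight_fibre_translate`, **`lintegral_fibre_translate_eq`** (`∫_S v(x s) ds = ∫_S wS`), and
  `lintegral_coveringWeight_ne_zero` (a covering weight has positive integral).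
* §3 **`exists_lintegral_quotientMeasure_comp_eq_mul_lintegral`** — transport `G ⧸ ker α → Q`.
* §4 **`exists_lintegral_comp_mul_weight_eq_mul_lintegral`** — the theorem; and the specialisation
  **`exists_lintegral_comp_mul_weight_eq_mul_setLIntegral`** to a strict fundamental domain `𝓕 ⊆ Q` of `Λ`
  in place of `wQ` (★ `isCoveringWeight_indicator`).

## References

* G. B. Folland, *A Course in Abstract Harmonic Analysis* (1995), §2.6 Thm. 2.49 (Weil's formula) [Folland1995].
* M. S. Raghunathan, *Discrete subgroups of Lie groups* (1972), Ch. I §1.4 (fundamental domains, covolumes)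
  [Raghunathan1972].
* J. D. Rogawski, *Automorphic Representations of Unitary Groups in Three Variables*, Ann. of Math. Stud. 123
  (1990), §7.2 (p. 94), §7.3 (p. 97) [Rogawski1990].
* A. Weil, *L'intégration dans les groupes topologiques et ses applications* (1940), §9; N. Bourbaki,
  *Intégration* VII §2 — cited through the held expositions above.
-/

set_option autoImplicit false

noncomputable section

open _root_.MeasureTheory _root_.MeasureTheory.Measure _root_.Topology Set Filter Function
open scoped ENNReal NNReal Pointwise

namespace Literature.MeasureTheory.Group

-- the quotient `G ⧸ ker α` carries the Borel σ-algebra supplied locally (binder / `letI := borel _`),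
-- which takes precedence over the quotient σ-algebra instance

section Algebra

variable {G Q : Type*} [CommGroup G] [CommGroup Q] (α : G →* Q) (Γ : Subgroup G)

/-! ## §1 Covering weights along `α`: `Γ`, `Λ = α(Γ)` and the fibre lattice `Γ_S = Γ ⊓ ker α` -/

/-- The action of the fibre lattice `Γ_S = Γ ⊓ ker α ≤ ker α` on `G` is left multiplication by the
underlying element (definitional bookkeeping). [folklore] -/
private theorem subgroupOf_smul_eq (σ : Γ.subgroupOf α.ker) (x : G) :
    σ • x = ((σ : α.ker) : G) * x := rfl

/-- The action of `Γ` on `G` is left multiplication (definitional bookkeeping). [folklore] -/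
private theorem subgroup_smul_eq (γ : Γ) (x : G) : γ • x = (γ : G) * x := rfl

/-- **A `Λ`-invariant function of `α x` is `Γ`-invariant** (`Λ = α(Γ)`). [cite: Folland1995, §2.6 Thm. 2.49] -/
theorem comp_smul_eq_of_forall_map {Z : Type*} {g : Q → Z}
    (hg : ∀ l ∈ Γ.map α, ∀ q : Q, g (l * q) = g q) (γ : Γ) (x : G) :
    g (α (γ • x)) = g (α x) := by
  rw [subgroup_smul_eq, map_mul]
  exact hg _ (Subgroup.mem_map_of_mem α γ.2) _

/-- The fibre of `Γ → Λ` over `α γ₀` is the coset `γ₀ Γ_S`: a bijection `Γ_S ≃ {γ ∈ Γ | α γ = α γ₀}`,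
`σ ↦ γ₀ σ`. [folklore] -/
private theorem exists_equiv_fibre (γ₀ : Γ) :
    ∃ e : Γ.subgroupOf α.ker ≃ {γ : Γ // α (γ : G) = α (γ₀ : G)},
      ∀ σ, ((e σ : Γ) : G) = (γ₀ : G) * ((σ : α.ker) : G) := by
  classical
  let f : Γ.subgroupOf α.ker → {γ : Γ // α (γ : G) = α (γ₀ : G)} := fun σ =>
    ⟨⟨(γ₀ : G) * ((σ : α.ker) : G), Γ.mul_mem γ₀.2 (Subgroup.mem_subgroupOf.1 σ.2)⟩, by
      change α ((γ₀ : G) * ((σ : α.ker) : G)) = α (γ₀ : G)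
      rw [map_mul, (σ : α.ker).2, mul_one]⟩
  refine ⟨Equiv.ofBijective f ⟨?_, ?_⟩, fun σ => rfl⟩
  · intro σ σ' h
    have h' : (γ₀ : G) * ((σ : α.ker) : G) = (γ₀ : G) * ((σ' : α.ker) : G) :=
      congrArg (fun z : {γ : Γ // α (γ : G) = α (γ₀ : G)} => ((z : Γ) : G)) h
    exact Subtype.ext (Subtype.ext (mul_left_cancel h'))
  · rintro ⟨γ, hγ⟩
    have hk : (γ₀ : G)⁻¹ * (γ : G) ∈ α.ker := by
      rw [MonoidHom.mem_ker, map_mul, map_inv, hγ, inv_mul_cancel]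
    refine ⟨⟨⟨(γ₀ : G)⁻¹ * (γ : G), hk⟩, Subgroup.mem_subgroupOf.2 (Γ.mul_mem (Γ.inv_mem γ₀.2) γ.2)⟩, ?_⟩
    exact Subtype.ext (Subtype.ext (mul_inv_cancel_left (γ₀ : G) (γ : G)))

/-- **`(wQ ∘ α) · v` IS A `Γ`-COVERING WEIGHT** when `wQ` is a `Λ`-covering weight on `Q` and `v` a
`Γ_S`-covering weight on `G`: `Σ_{γ ∈ Γ} wQ(α(γx)) v(γx) = Σ_{λ ∈ Λ} wQ(λ α x) Σ_{σ ∈ Γ_S} v(σ γ_λ x) = 1`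
(the sum over `Γ` regrouped along the fibres of `Γ → Λ`, each a `Γ_S`-coset). [cite: Folland1995, §2.6 Thm. 2.49]
[cite: Raghunathan1972, Ch. I §1.4] -/
theorem isCoveringWeight_comp_mul [MeasurableSpace G] [MeasurableSpace Q] (hα : Measurable α)
    {wQ : Q → ℝ≥0∞} (hwQ : IsCoveringWeight (Γ.map α) wQ)
    {v : G → ℝ≥0∞} (hv : IsCoveringWeight (Γ.subgroupOf α.ker) v) :
    IsCoveringWeight Γ (fun x => wQ (α x) * v x) := by
  classical
  refine ⟨(hwQ.measurable.comp hα).mul hv.measurable, fun x => ?_⟩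
  rw [coveringSum_apply]
  -- regroup the sum over `Γ` along `p : Γ → Λ`
  let p : Γ → Γ.map α := fun γ => ⟨α (γ : G), Subgroup.mem_map_of_mem α γ.2⟩
  rw [← (Equiv.sigmaFiberEquiv p).tsum_eq, ENNReal.tsum_sigma']
  -- each fibre contributes `wQ(λ α x)`
  have hfib : ∀ l : Γ.map α, ∑' γ : {γ : Γ // p γ = l},
      wQ (α ((γ : Γ) • x)) * v ((γ : Γ) • x) = wQ ((l : Q) * α x) := by
    intro l
    obtain ⟨g₀, hg₀, hl⟩ := Subgroup.mem_map.1 l.2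
    -- the fibre over `l` is `γ₀ Γ_S`
    have hp : ∀ γ : Γ, p γ = l ↔ α (γ : G) = α ((⟨g₀, hg₀⟩ : Γ) : G) := fun γ => by
      constructor
      · intro h; have h' := congrArg Subtype.val h; simpa [p, hl] using h'
      · intro h; exact Subtype.ext (by simpa [p, hl] using h)
    obtain ⟨e, he⟩ := exists_equiv_fibre α Γ ⟨g₀, hg₀⟩
    let e' : Γ.subgroupOf α.ker ≃ {γ : Γ // p γ = l} :=
      e.trans (Equiv.subtypeEquivRight fun γ => (hp γ).symm)
    rw [← e'.tsum_eq]
    have hval : ∀ σ, (((e' σ : {γ : Γ // p γ = l}) : Γ) : G) = g₀ * ((σ : α.ker) : G) := fun σ => he σ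
    simp_rw [subgroup_smul_eq, hval]
    have h1 : ∀ σ : Γ.subgroupOf α.ker, wQ (α (g₀ * ((σ : α.ker) : G) * x)) = wQ ((l : Q) * α x) := by
      intro σ
      rw [map_mul, map_mul, (σ : α.ker).2, mul_one, hl]
    simp_rw [h1, ENNReal.tsum_mul_left]
    have h2 : ∑' σ : Γ.subgroupOf α.ker, v (g₀ * ((σ : α.ker) : G) * x) = 1 := by
      have h := hv.coveringSum_eq (g₀ * x)
      rw [coveringSum_apply] at h
      rw [← h]
      refine tsum_congr fun σ => ?_
      rw [subgroupOf_smul_eq]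
      congr 1
      simp only [mul_assoc, mul_left_comm]
    rw [h2, mul_one]
  simp only [Equiv.sigmaFiberEquiv_apply]
  simp_rw [hfib]
  have h := hwQ.coveringSum_eq (α x)
  rw [coveringSum_apply] at h
  exact h

/-- **A `Γ_S`-covering weight on `G` exists** as soon as `Γ` is discrete (`Γ_S = Γ ⊓ ker α` is then a
discrete subgroup of the second countable `G`; ★ `exists_isCoveringWeight`, transported along
`Γ.subgroupOf (ker α) ≃* Γ ⊓ ker α`). [folklore] -/
private theorem exists_isCoveringWeight_fibre [TopologicalSpace G] [IsTopologicalGroup G]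
    [SecondCountableTopology G] [MeasurableSpace G] [BorelSpace G] [DiscreteTopology Γ] :
    ∃ v : G → ℝ≥0∞, IsCoveringWeight (Γ.subgroupOf α.ker) v := by
  set Γ' : Subgroup G := (Γ.subgroupOf α.ker).map α.ker.subtype with hΓ'
  have hle : (Γ' : Set G) ⊆ (Γ : Set G) := by
    rintro _ ⟨σ, hσ, rfl⟩
    exact Subgroup.mem_subgroupOf.1 hσ
  haveI : DiscreteTopology Γ' := DiscreteTopology.of_subset ‹DiscreteTopology Γ› hle
  obtain ⟨v, hvm, hv⟩ := exists_isCoveringWeight Γ'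
  let e : Γ.subgroupOf α.ker ≃* Γ' := (Γ.subgroupOf α.ker).equivMapOfInjective α.ker.subtype Subtype.val_injective
  refine ⟨v, hvm, fun x => ?_⟩
  rw [coveringSum_apply, ← (hv x), coveringSum_apply, ← e.symm.tsum_eq]
  refine tsum_congr fun τ => ?_
  rw [subgroupOf_smul_eq]
  change v (((e (e.symm τ) : Γ') : G) * x) = v (τ • x)
  rw [MulEquiv.apply_symm_apply]
  rfl

/-- `Γ_S` is countable when `Γ` is. [cite: Folland1995, §2.6] -/
theorem countable_subgroupOf_ker [Countable Γ] : Countable (Γ.subgroupOf α.ker) := by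
  have hinj : Function.Injective fun σ : Γ.subgroupOf α.ker =>
      (⟨((σ : α.ker) : G), Subgroup.mem_subgroupOf.1 σ.2⟩ : Γ) := by
    intro σ σ' h
    exact Subtype.ext (Subtype.ext (congrArg (fun z : Γ => (z : G)) h))
  exact hinj.countable

end Algebra

section Fibre

variable {G Q : Type*} [CommGroup G] [CommGroup Q] (α : G →* Q) (Γ : Subgroup G)
  [TopologicalSpace G] [IsTopologicalGroup G] [MeasurableSpace G] [BorelSpace G]

/-! ## §2 The fibre integral of a `Γ_S`-covering weight is the covolume of `Γ_S` in `S` -/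

/-- Translating a `Γ_S`-covering weight on `G` to the fibre `x S`: `s ↦ v(x s)` is a `Γ_S`-covering weight
on `S = ker α` (`G` abelian). [cite: Folland1995, §2.6] -/
theorem isCoveringWeight_fibre_translate {v : G → ℝ≥0∞}
    (hv : IsCoveringWeight (Γ.subgroupOf α.ker) v) (x : G) :
    IsCoveringWeight (Γ.subgroupOf α.ker) (fun s : α.ker => v (x * (s : G))) := by
  refine ⟨hv.measurable.comp ((measurable_const_mul x).comp measurable_subtype_coe), fun s => ?_⟩
  have h := hv.coveringSum_eq (x * (s : G))
  rw [coveringSum_apply] at h ⊢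
  rw [← h]
  refine tsum_congr fun σ => ?_
  change v (x * ((((σ : α.ker) * s : α.ker)) : G)) = v (((σ : α.ker) : G) * (x * (s : G)))
  rw [Subgroup.coe_mul, mul_left_comm]

/-- The fibre lattice `Γ_S = Γ ⊓ ker α ≤ ker α` acts measurably on `S = ker α` by left multiplication.
[cite: Folland1995, §2.6] -/
theorem measurableConstSMul_subgroupOf_ker :
    MeasurableConstSMul (Γ.subgroupOf α.ker) α.ker :=
  ⟨fun σ => measurable_const_mul ((σ : Γ.subgroupOf α.ker) : α.ker)⟩

/-- A left-invariant measure on `S = ker α` is invariant under the fibre lattice. [cite: Folland1995, §2.6] -/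
theorem smulInvariantMeasure_subgroupOf_ker (μS : Measure α.ker) [μS.IsMulLeftInvariant] :
    SMulInvariantMeasure (Γ.subgroupOf α.ker) α.ker μS :=
  ⟨fun σ t _ht => by
    rw [show (fun s : α.ker => σ • s) ⁻¹' t = (fun s : α.ker => ((σ : Γ.subgroupOf α.ker) : α.ker) * s) ⁻¹' t
        from rfl, measure_preimage_mul]⟩

/-- **The fibre integral is the covolume**: for a `Γ_S`-covering weight `v` on `G`, a `Γ_S`-covering weight
`wS` on `S = ker α` and a left-invariant `μS` on `S`, `∫_S v(x s) dμS(s) = ∫_S wS dμS` for EVERY `x ∈ G`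
(weight-independence ★ `lintegral_mul_eq_of_coveringSum_eq` on `S` with `F = 1`). [cite: Folland1995, §2.6 Thm. 2.49] -/
theorem lintegral_fibre_translate_eq [Countable Γ] (μS : Measure α.ker) [μS.IsMulLeftInvariant]
    {v : G → ℝ≥0∞} (hv : IsCoveringWeight (Γ.subgroupOf α.ker) v)
    {wS : α.ker → ℝ≥0∞} (hwS : IsCoveringWeight (Γ.subgroupOf α.ker) wS) (x : G) :
    ∫⁻ s, v (x * (s : G)) ∂μS = ∫⁻ s, wS s ∂μS := by
  haveI := measurableConstSMul_subgroupOf_ker α Γ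
  haveI := smulInvariantMeasure_subgroupOf_ker α Γ μS
  haveI := countable_subgroupOf_ker α Γ
  have hvx := isCoveringWeight_fibre_translate α Γ hv x
  have h := lintegral_mul_eq_of_coveringSum_eq μS (F := fun _ => (1 : ℝ≥0∞)) measurable_const
    (fun _ _ => rfl) hvx.measurable hwS.measurable one_ne_zero ENNReal.one_ne_top hvx.coveringSum_eq
    hwS.coveringSum_eq
  simpa only [one_mul] using h

/-- **A covering weight has non-zero integral** against a non-zero invariant measure: if `∫ wS dμS = 0` then
`wS = 0` a.e., hence (countably many translates, invariance) `Σ_σ wS(σ s) = 0` for a.e. `s` — contradicting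
`= 1`. [cite: Folland1995, §2.6] -/
theorem lintegral_coveringWeight_ne_zero [Countable Γ] (μS : Measure α.ker)
    [μS.IsMulLeftInvariant] (hμS : μS ≠ 0)
    {wS : α.ker → ℝ≥0∞} (hwS : IsCoveringWeight (Γ.subgroupOf α.ker) wS) :
    ∫⁻ s, wS s ∂μS ≠ 0 := by
  haveI := measurableConstSMul_subgroupOf_ker α Γ
  haveI := smulInvariantMeasure_subgroupOf_ker α Γ μS
  haveI := countable_subgroupOf_ker α Γ
  intro h0
  -- `∫ (Σ_σ wS(σ s)) dμS = Σ_σ ∫ wS(σ s) = Σ_σ ∫ wS = 0`, but the integrand is `1`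
  have hsum : ∫⁻ s, coveringSum (Γ.subgroupOf α.ker) wS s ∂μS = 0 := by
    simp_rw [coveringSum_apply]
    have hm : ∀ σ : Γ.subgroupOf α.ker, AEMeasurable (fun s : α.ker => wS (σ • s)) μS := fun σ =>
      (hwS.measurable.comp (measurable_const_smul σ)).aemeasurable
    rw [lintegral_tsum hm]
    refine ENNReal.tsum_eq_zero.2 fun σ => ?_
    have h := (measurePreserving_smul σ μS).lintegral_comp hwS.measurable
    rw [h, h0]
  simp_rw [hwS.coveringSum_eq, lintegral_one] at hsum
  exact hμS (Measure.measure_univ_eq_zero.1 hsum)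

end Fibre

section Transport

variable {G Q : Type*} [CommGroup G] [TopologicalSpace G] [IsTopologicalGroup G] [LocallyCompactSpace G]
  [SecondCountableTopology G] [T2Space G] [MeasurableSpace G] [BorelSpace G]
  [CommGroup Q] [TopologicalSpace Q] [IsTopologicalGroup Q] [LocallyCompactSpace Q]
  [SecondCountableTopology Q] [T2Space Q] [MeasurableSpace Q] [BorelSpace Q]
  (α : G →* Q)

/-! ## §3 Transport of the quotient measure along `G ⧸ ker α ≃ Q` -/

omit [IsTopologicalGroup G] [LocallyCompactSpace G] [SecondCountableTopology G] [T2Space G] [MeasurableSpace G]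
  [BorelSpace G] [MeasurableSpace Q] [BorelSpace Q] in
/-- The kernel of a continuous homomorphism into a Hausdorff group is closed. [cite: Folland1995, §2.6] -/
theorem isClosed_ker_of_continuous (hαc : Continuous α) : IsClosed ((α.ker : Subgroup G) : Set G) := by
  have h : ((α.ker : Subgroup G) : Set G) = α ⁻¹' {1} := by
    ext x
    simp only [SetLike.mem_coe, MonoidHom.mem_ker, Set.mem_preimage, Set.mem_singleton_iff]
  rw [h]
  exact isClosed_singleton.preimage hαc

omit [IsTopologicalGroup G] [LocallyCompactSpace G] [SecondCountableTopology G] [T2Space G] [MeasurableSpace G]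
  [BorelSpace G] [IsTopologicalGroup Q] [LocallyCompactSpace Q] [SecondCountableTopology Q] [T2Space Q]
  [MeasurableSpace Q] [BorelSpace Q] in
/-- `ᾱ : G ⧸ ker α → Q` (Mathlib `QuotientGroup.kerLift`) is continuous when `α` is. [cite: Folland1995, §2.6] -/
theorem continuous_kerLift (hαc : Continuous α) : Continuous (QuotientGroup.kerLift α) := by
  have h1 : Continuous (QuotientGroup.kerLift α ∘ QuotientGroup.mk) := by
    have h2 : (QuotientGroup.kerLift α ∘ QuotientGroup.mk : G → Q) = α :=
      funext fun g => QuotientGroup.kerLift_mk α g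
    rw [h2]; exact hαc
  exact (QuotientGroup.isQuotientMap_mk α.ker).continuous_iff.2 h1

/-- **The quotient measure of `G ⧸ ker α`, transported to `Q` along `ᾱ : G ⧸ ker α ≃ Q`, is a positive
multiple of the Haar measure**: for a continuous OPEN surjective `α`, Haar measures `μG` on `G`, `μS` on
`ker α`, `μQ` on `Q`, there is `c ∈ (0, ∞)` with `∫_{G ⧸ ker α} h(ᾱ x) d(μG∕μS)(x) = c ∫_Q h dμQ` for every
Borel `h ≥ 0` (`ᾱ =` Mathlib `QuotientGroup.kerLift`; `ᾱ` is a homeomorphism and an isomorphism, so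
`ᾱ_*(μG∕μS)` is a left-invariant Radon measure on `Q`, Mathlib `isMulLeftInvariant_eq_smul`). The binders
`[μS.IsInvInvariant] [μG.IsMulRightInvariant]` are those of ★ `quotientMeasure`; for Haar measures on the abelian
`ker α`, `G` they hold (§4 derives them). [cite: Folland1995, §2.6 Thm. 2.49] -/
theorem exists_lintegral_quotientMeasure_comp_eq_mul_lintegral (hαc : Continuous α) (hαo : IsOpenMap α)
    (hαs : Function.Surjective α) (μS : Measure α.ker) [IsHaarMeasure μS] [μS.IsInvInvariant]
    (μG : Measure G) [IsHaarMeasure μG] [μG.IsMulRightInvariant] (μQ : Measure Q) [IsHaarMeasure μQ]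
    [MeasurableSpace (G ⧸ α.ker)] [BorelSpace (G ⧸ α.ker)] :
    ∃ c : ℝ≥0∞, c ≠ 0 ∧ c ≠ ∞ ∧ ∀ h : Q → ℝ≥0∞, Measurable h →
      ∫⁻ x, h (QuotientGroup.kerLift α x) ∂quotientMeasure α.ker μS (isClosed_ker_of_continuous α hαc) μG =
        c * ∫⁻ q, h q ∂μQ := by
  haveI : IsClosed ((α.ker : Subgroup G) : Set G) := isClosed_ker_of_continuous α hαc
  set qm : Measure (G ⧸ α.ker) := quotientMeasure α.ker μS (isClosed_ker_of_continuous α hαc) μG with hqm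
  -- `ᾱ : G ⧸ ker α ≃* Q` is a homeomorphism
  set e : G ⧸ α.ker ≃* Q := QuotientGroup.quotientKerEquivOfSurjective α hαs with hedef
  have he : ∀ x, e x = QuotientGroup.kerLift α x := fun x => rfl
  have hemk : ∀ g : G, e (QuotientGroup.mk g) = α g := fun g => rfl
  have hec : Continuous e := by
    have h1 : Continuous (e ∘ QuotientGroup.mk) := by
      have h2 : (e ∘ QuotientGroup.mk : G → Q) = α := funext fun g => hemk g
      rw [h2]; exact hαc
    exact (QuotientGroup.isQuotientMap_mk α.ker).continuous_iff.2 h1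
  have heo : IsOpenMap e := by
    intro U hU
    have h1 : e '' U = α '' (QuotientGroup.mk ⁻¹' U) := by
      ext q
      constructor
      · rintro ⟨x, hx, rfl⟩
        induction x using QuotientGroup.induction_on with
        | H g => exact ⟨g, hx, (hemk g).symm⟩
      · rintro ⟨g, hg, rfl⟩
        exact ⟨QuotientGroup.mk g, hg, hemk g⟩
    rw [h1]
    exact hαo _ (hU.preimage QuotientGroup.continuous_mk)
  let eₜ : G ⧸ α.ker ≃ₜ Q := e.toEquiv.toHomeomorphOfContinuousOpen hec heo
  have heₜ : ∀ x, eₜ x = e x := fun x => rfl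
  let eₘ : G ⧸ α.ker ≃ᵐ Q := eₜ.toMeasurableEquiv
  have heₘ : ∀ x, eₘ x = e x := fun x => by
    change (eₜ.toMeasurableEquiv : G ⧸ α.ker → Q) x = e x
    rw [Homeomorph.toMeasurableEquiv_coe]; rfl
  have hem : Measurable e := by
    have h := eₘ.measurable
    have h2 : (eₘ : G ⧸ α.ker → Q) = e := funext heₘ
    rwa [h2] at h
  -- the transported measure
  set μ' : Measure Q := Measure.map e qm with hμ'
  haveI : IsFiniteMeasureOnCompacts μ' := ⟨fun K hK => by
    rw [hμ', Measure.map_apply hem hK.measurableSet]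
    have hK' : IsCompact (e ⁻¹' K) := by
      have h2 : e ⁻¹' K = eₜ ⁻¹' K := rfl
      rw [h2]
      exact eₜ.isCompact_preimage.2 hK
    exact hK'.measure_lt_top⟩
  haveI : μ'.IsMulLeftInvariant := by
    refine ⟨fun q => ?_⟩
    obtain ⟨g₀, rfl⟩ := hαs q
    rw [hμ', Measure.map_map (measurable_const_mul _) hem]
    have h2 : ((fun y : Q => α g₀ * y) ∘ e) = e ∘ fun x : G ⧸ α.ker => g₀ • x := by
      funext x
      induction x using QuotientGroup.induction_on with
      | H g =>
        change α g₀ * e (QuotientGroup.mk g) = e (QuotientGroup.mk (g₀ * g))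
        rw [hemk, hemk, map_mul]
    rw [h2, ← Measure.map_map hem (measurable_const_smul g₀), MeasureTheory.map_smul]
  have hμ'eq : μ' = haarScalarFactor μ' μQ • μQ := isMulLeftInvariant_eq_smul μ' μQ
  have hμ'0 : μ' ≠ 0 := by
    rw [hμ']
    intro h0
    exact quotientMeasure_ne_zero α.ker μS (isClosed_ker_of_continuous α hαc) μG
      ((Measure.map_eq_zero_iff hem.aemeasurable).1 h0)
  refine ⟨(haarScalarFactor μ' μQ : ℝ≥0∞), ?_, ENNReal.coe_ne_top, fun h hh => ?_⟩
  · intro h0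
    apply hμ'0
    rw [hμ'eq, ENNReal.coe_eq_zero.1 h0, zero_smul]
  · calc ∫⁻ x, h (QuotientGroup.kerLift α x) ∂qm = ∫⁻ x, h (eₘ x) ∂qm := by
          simp_rw [heₘ, he]
      _ = ∫⁻ q, h q ∂Measure.map eₘ qm := (lintegral_map_equiv h eₘ).symm
      _ = ∫⁻ q, h q ∂μ' := by
          rw [hμ', show (⇑eₘ : G ⧸ α.ker → Q) = ⇑e from funext heₘ]
      _ = (haarScalarFactor μ' μQ : ℝ≥0∞) * ∫⁻ q, h q ∂μQ := by
          conv_lhs => rw [hμ'eq]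
          rw [lintegral_smul_measure, ENNReal.smul_def, smul_eq_mul]

end Transport

section Main

variable {G Q : Type*} [CommGroup G] [TopologicalSpace G] [IsTopologicalGroup G] [LocallyCompactSpace G]
  [SecondCountableTopology G] [T2Space G] [MeasurableSpace G] [BorelSpace G]
  [CommGroup Q] [TopologicalSpace Q] [IsTopologicalGroup Q] [LocallyCompactSpace Q]
  [SecondCountableTopology Q] [T2Space Q] [MeasurableSpace Q] [BorelSpace Q]
  (α : G →* Q) (Γ : Subgroup G)

/-! ## §4 The unfolding theorem -/

/-- **UNFOLDING ALONG A QUOTIENT HOMOMORPHISM (covering-weight form).** Let `G`, `Q` be locally compact second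
countable Hausdorff abelian groups with Haar measures `μG`, `μQ`, `α : G →* Q` a continuous open surjective
homomorphism with a Haar measure `μS` on `S = ker α`, `Γ ≤ G` a countable discrete subgroup, `Λ = α(Γ)`, and
suppose the fibre lattice `Γ_S = Γ ⊓ S` has finite covolume in `S`, witnessed by a `Γ_S`-covering weight `wS` on
`S` with `∫ wS dμS < ∞`. Then there is `C ∈ (0, ∞)` such that for every `Γ`-covering weight `w` on `G`, every
`Λ`-covering weight `wQ` on `Q` and every Borel `Λ`-invariant `g : Q → [0, ∞]`,
`∫⁻ g(α x) w(x) dμG = C · ∫⁻ g(q) wQ(q) dμQ` — i.e. `∫_{Γ∖G} g ∘ α = C ∫_{Λ∖Q} g` with `C = vol(Γ_S∖S) ×`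
(Haar normalisation). This is Weil's «`dx = ds dẋ`» for `S ⊴ G` combined with the lattices (Rogawski (1990)
p. 94: `∫_{𝐙M∖𝐌} = m(𝐙S∖𝐒)∫_{NE^*∖NI_E}` along `α₃`; p. 97 along `α₁`). [cite: Folland1995, §2.6 Thm. 2.49]
[cite: Raghunathan1972, Ch. I §1.4] [cite: Rogawski1990, §7.2 (p. 94); §7.3 (p. 97)] -/
theorem exists_lintegral_comp_mul_weight_eq_mul_lintegral (hαc : Continuous α) (hαo : IsOpenMap α)
    (hαs : Function.Surjective α) (μG : Measure G) [IsHaarMeasure μG] (μQ : Measure Q) [IsHaarMeasure μQ]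
    (μS : Measure α.ker) [IsHaarMeasure μS] [Countable Γ] [DiscreteTopology Γ]
    {wS : α.ker → ℝ≥0∞} (hwS : IsCoveringWeight (Γ.subgroupOf α.ker) wS) (hfin : ∫⁻ s, wS s ∂μS ≠ ∞) :
    ∃ C : ℝ≥0∞, C ≠ 0 ∧ C ≠ ∞ ∧ ∀ w : G → ℝ≥0∞, IsCoveringWeight Γ w →
      ∀ wQ : Q → ℝ≥0∞, IsCoveringWeight (Γ.map α) wQ →
      ∀ g : Q → ℝ≥0∞, Measurable g → (∀ l ∈ Γ.map α, ∀ q : Q, g (l * q) = g q) →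
        ∫⁻ x, g (α x) * w x ∂μG = C * ∫⁻ q, g q * wQ q ∂μQ := by
  haveI : IsClosed ((α.ker : Subgroup G) : Set G) := isClosed_ker_of_continuous α hαc
  haveI : μG.IsMulRightInvariant :=
    ⟨fun g => by simpa only [mul_comm] using map_mul_left_eq_self μG g⟩
  -- `μS` is regular (Haar on the locally compact second countable `ker α`), hence inversion invariant
  haveI : μS.Regular := by
    obtain ⟨K, hK, hK1⟩ := exists_compact_mem_nhds (1 : α.ker)
    exact regular_of_isMulLeftInvariant hK ⟨1, mem_interior_iff_mem_nhds.2 hK1⟩ hK.measure_lt_top.ne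
  letI : MeasurableSpace (G ⧸ α.ker) := borel _
  haveI : BorelSpace (G ⧸ α.ker) := ⟨rfl⟩
  haveI : MeasurableConstSMul Γ G := ⟨fun γ => measurable_const_mul (γ : G)⟩
  haveI : SMulInvariantMeasure Γ G μG := ⟨fun γ t _ht => by
    rw [show (fun x : G => γ • x) ⁻¹' t = (fun x : G => (γ : G) * x) ⁻¹' t from rfl, measure_preimage_mul]⟩
  -- the transport constant and a fibre weight
  obtain ⟨c, hc0, hct, hc⟩ := exists_lintegral_quotientMeasure_comp_eq_mul_lintegral α hαc hαo hαs μS μG μQ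
  obtain ⟨v, hv⟩ := exists_isCoveringWeight_fibre α Γ
  have hμS : μS ≠ 0 := by
    intro h
    have h1 := isOpen_univ.measure_pos μS Set.univ_nonempty
    simp [h] at h1
  have hV0 : ∫⁻ s, wS s ∂μS ≠ 0 := lintegral_coveringWeight_ne_zero α Γ μS hμS hwS
  refine ⟨(∫⁻ s, wS s ∂μS) * c, mul_ne_zero hV0 hc0, ENNReal.mul_ne_top hfin hct,
    fun w hw wQ hwQ g hg hginv => ?_⟩
  -- Step 1: replace `w` by `(wQ ∘ α) · v`
  have hw' := isCoveringWeight_comp_mul α Γ hαc.measurable hwQ hv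
  have hF : Measurable fun x => g (α x) := hg.comp hαc.measurable
  have hFinv : ∀ (γ : Γ) (x : G), g (α (γ • x)) = g (α x) := fun γ x =>
    comp_smul_eq_of_forall_map α Γ hginv γ x
  have step1 : ∫⁻ x, g (α x) * w x ∂μG = ∫⁻ x, g (α x) * (wQ (α x) * v x) ∂μG :=
    lintegral_mul_eq_of_coveringSum_eq μG hF hFinv hw.measurable hw'.measurable one_ne_zero
      ENNReal.one_ne_top hw.coveringSum_eq hw'.coveringSum_eq
  -- Step 2: Weil along `S` with constant one; the fibre integral is `g(αx) wQ(αx) · ∫ wS`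
  have hf : Measurable fun x => g (α x) * (wQ (α x) * v x) :=
    hF.mul ((hwQ.measurable.comp hαc.measurable).mul hv.measurable)
  have step2 := lintegral_fiberLIntegral_quotientMeasure α.ker μS μG hf
  have hfib : ∀ x : G ⧸ α.ker,
      fiberLIntegral α.ker μS (fun x => g (α x) * (wQ (α x) * v x)) x =
        g (QuotientGroup.kerLift α x) * wQ (QuotientGroup.kerLift α x) * ∫⁻ s, wS s ∂μS := by
    intro x
    induction x using QuotientGroup.induction_on with
    | H y =>
      rw [fiberLIntegral_mk, QuotientGroup.kerLift_mk]
      have h1 : ∀ s : α.ker, α (y * (s : G)) = α y := fun s => by rw [map_mul, s.2, mul_one]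
      simp_rw [h1]
      have hm2 : Measurable fun s : α.ker => v (y * (s : G)) :=
        hv.measurable.comp ((measurable_const_mul y).comp measurable_subtype_coe)
      have hm1 : Measurable fun s : α.ker => wQ (α y) * v (y * (s : G)) := measurable_const.mul hm2
      rw [lintegral_const_mul (g (α y)) hm1, lintegral_const_mul (wQ (α y)) hm2,
        lintegral_fibre_translate_eq α Γ μS hv hwS y, mul_assoc]
  -- Step 3: transport to `Q`
  have hh : Measurable fun q => g q * wQ q := hg.mul hwQ.measurable
  have step3 := hc _ hh
  calc ∫⁻ x, g (α x) * w x ∂μG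
      = ∫⁻ x, g (α x) * (wQ (α x) * v x) ∂μG := step1
    _ = ∫⁻ x, fiberLIntegral α.ker μS (fun x => g (α x) * (wQ (α x) * v x)) x
          ∂quotientMeasure α.ker μS (isClosed_ker_of_continuous α hαc) μG := step2.symm
    _ = ∫⁻ x, g (QuotientGroup.kerLift α x) * wQ (QuotientGroup.kerLift α x) * ∫⁻ s, wS s ∂μS
          ∂quotientMeasure α.ker μS (isClosed_ker_of_continuous α hαc) μG := lintegral_congr hfib
    _ = (∫⁻ x, g (QuotientGroup.kerLift α x) * wQ (QuotientGroup.kerLift α x)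
          ∂quotientMeasure α.ker μS (isClosed_ker_of_continuous α hαc) μG) * ∫⁻ s, wS s ∂μS :=
        lintegral_mul_const _ (hh.comp (continuous_kerLift α hαc).measurable)
    _ = (∫⁻ s, wS s ∂μS) * c * ∫⁻ q, g q * wQ q ∂μQ := by
        rw [step3]; ring

/-- **The same against a strict fundamental domain of `Λ` in `Q`**: if `𝓕 ⊆ Q` is measurable and meets every
`Λ`-orbit exactly once, then `∫⁻ g(α x) w(x) dμG = C · ∫⁻_{𝓕} g dμQ` for every `Γ`-covering weight `w` and every
Borel `Λ`-invariant `g ≥ 0` (the indicator of `𝓕` is a covering weight, ★ `isCoveringWeight_indicator`) — the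
shape `∫_{E^×∖𝕀_E} (…) = ∫_{𝓕} (…)` of the idele-class files of the tree (`IsIdeleClassDomain`).
[cite: Folland1995, §2.6 Thm. 2.49] [cite: Rogawski1990, §7.2 (p. 94); §7.3 (p. 97)] -/
theorem exists_lintegral_comp_mul_weight_eq_mul_setLIntegral (hαc : Continuous α) (hαo : IsOpenMap α)
    (hαs : Function.Surjective α) (μG : Measure G) [IsHaarMeasure μG] (μQ : Measure Q) [IsHaarMeasure μQ]
    (μS : Measure α.ker) [IsHaarMeasure μS] [Countable Γ] [DiscreteTopology Γ]
    {wS : α.ker → ℝ≥0∞} (hwS : IsCoveringWeight (Γ.subgroupOf α.ker) wS) (hfin : ∫⁻ s, wS s ∂μS ≠ ∞) :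
    ∃ C : ℝ≥0∞, C ≠ 0 ∧ C ≠ ∞ ∧ ∀ w : G → ℝ≥0∞, IsCoveringWeight Γ w →
      ∀ 𝓕 : Set Q, MeasurableSet 𝓕 → (∀ q : Q, ∃! l : Γ.map α, l • q ∈ 𝓕) →
      ∀ g : Q → ℝ≥0∞, Measurable g → (∀ l ∈ Γ.map α, ∀ q : Q, g (l * q) = g q) →
        ∫⁻ x, g (α x) * w x ∂μG = C * ∫⁻ q in 𝓕, g q ∂μQ := by
  obtain ⟨C, hC0, hCt, hC⟩ :=
    exists_lintegral_comp_mul_weight_eq_mul_lintegral α Γ hαc hαo hαs μG μQ μS hwS hfin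
  refine ⟨C, hC0, hCt, fun w hw 𝓕 h𝓕 huniq g hg hginv => ?_⟩
  rw [hC w hw (𝓕.indicator 1) (isCoveringWeight_indicator h𝓕 huniq) g hg hginv, ← lintegral_indicator h𝓕]
  congr 1
  refine lintegral_congr fun q => ?_
  by_cases hq : q ∈ 𝓕
  · rw [Set.indicator_of_mem hq, Set.indicator_of_mem hq, Pi.one_apply, mul_one]
  · rw [Set.indicator_of_notMem hq, Set.indicator_of_notMem hq, mul_zero]

end Main

end Literature.MeasureTheory.Group
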